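import Summits.Ventures.PercRepro.S1CellTable
import Summits.Ventures.PercRepro.S1CoreGeneralRecut
import Summits.Ventures.PercRepro.RankLevelSetLevelFourAll
import Summits.Ventures.PercRepro.SevenThreeQThree
import Summits.Ventures.PercRepro.RankLevelSetFrameLarge
import Summits.Ventures.PercRepro.RankLevelSetFrameQM

/-!
# PercRepro — S1 LEVEL FOUR: C-025 at level `4` for every finite matroid and every `p ≥ 27` (p4, gen 14; SUBCLAIM-S1)

`proofs/SUBCLAIM-S1-p2.md` §2 (the reduction (R)) and §6, typed per `proofs/S1-LEAN-SPEC-p2.md` L5′ (v3) — the glue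
of the S1 modules with the landed tree:

* **`c025_core_four_cell`** — the `e`-free core at `26 ≤ p ≤ 59`, corank `5 ≤ d ≤ 15`: `rls_of_cellOK` on the kernel
  table `table_26_59` (`S1CellTable`);
* **`c025_core_four_all_corank`** — the core at rank `p ≥ 26` and EVERY corank `≥ 5`: the table for `p ≤ 59`,
  `d ≤ 15`; p2's re-cut `S1.c025_core_four_ten'` (`S1CoreGeneralRecut`) for `p ≥ 26`, `d ≥ 16`; `ThmN.c025_four_large`
  for `p ≥ 60`;
* **`c025_four_twentyseven`** — THE END THEOREM: every finite matroid satisfies `ThmN.RLS M p 4` for every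
  `p ≥ 27`, by night-1's wrapper `ThmN.rls_succ_large 3 4 26` with `hprev = SevenThree.c025_three_all` (the
  `q = 3` row), `hsmall` = `RLS_of_ncard_lt` / `RLS_of_ncard_eq` (corank `≤ 4`), `hcore` = the line above;
* `c025_four_twentyseven'` — the same in the literal vocabulary of `C025`.
Axioms: standard.
-/

open scoped Matroid

namespace PercRepro

namespace S1

variable {α : Type}

/-- **(L5.1) The core cells `26 ≤ p ≤ 59`, `5 ≤ d ≤ 15`.** -/
theorem c025_core_four_cell (M : Matroid α) [M.Finite] (p d : ℕ) (hp : 26 ≤ p) (hp' : p ≤ 59)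
    (hd : 5 ≤ d) (hd' : d ≤ 15) (hR : M.eRank = (p : ℕ∞)) (hn : M.E.ncard = p + d)
    (hfree : ∀ e ∈ M.E, ∃ A ⊆ M.E \ {e}, e ∉ M.closure A ∧ e ∉ M.closure ((M.E \ {e}) \ A)) :
    ThmN.RLS M p 4 :=
  rls_of_cellOK M p d hR hn hfree (by omega) (table_26_59 p hp hp' d hd hd')

/-- **(L5.2) The `e`-free core at rank `p ≥ 26` and every corank `≥ 5`.** -/
theorem c025_core_four_all_corank (M : Matroid α) [M.Finite] (p : ℕ) (hp : 26 ≤ p)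
    (hR : M.eRank = (p : ℕ∞)) (hbig : p + 4 < M.E.ncard)
    (hfree : ∀ e ∈ M.E, ∃ A ⊆ M.E \ {e}, e ∉ M.closure A ∧ e ∉ M.closure ((M.E \ {e}) \ A)) :
    ThmN.RLS M p 4 := by
  rcases Nat.lt_or_ge p 60 with h59 | h60
  · rcases Nat.lt_or_ge M.E.ncard (p + 16) with h | h
    · exact c025_core_four_cell M p (M.E.ncard - p) hp (by omega) (by omega) (by omega) hR (by omega) hfree
    · exact c025_core_four_ten' M p hp hR (by omega) hfree
  · exact ThmN.c025_four_large M p h60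

/-- **THE END THEOREM (L5.3)**: every finite matroid satisfies C-025 at level `4` for every `p ≥ 27`:
`Φ(p, 4)·#{A ⊆ E : r(A) = p, r(E ∖ A) = 4} ≤ #{A ⊆ E : 4 < r(A) < p}`. -/
theorem c025_four_twentyseven (M : Matroid α) [M.Finite] (p : ℕ) (hp : 27 ≤ p) : ThmN.RLS M p 4 := by
  refine ThmN.rls_succ_large (α := α) 3 4 26 ?_ ?_ ?_ M p hp (by omega)
  · -- level `3` for every `p ≥ 26` (the `q = 3` row)
    intro M' _ p' _ hp'
    exact SevenThree.c025_three_all M' p' (by omega)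
  · -- corank `≤ 4`: `U = ∅` or Theorem M
    intro M' _ p' _ hn _
    rcases Nat.lt_or_ge M'.E.ncard (p' + 4) with h | h
    · exact ThmN.RLS_of_ncard_lt M' h
    · exact ThmN.RLS_of_ncard_eq M' (by omega)
  · -- the core
    intro M' _ p' hP hR hbig _ hfree
    exact c025_core_four_all_corank M' p' hP hR hbig hfree

/-- The end theorem in the literal vocabulary of `C025` (the body at `(p, 4)`). -/
theorem c025_four_twentyseven' (M : Matroid α) [M.Finite] (p : ℕ) (hp : 27 ≤ p) :
    phiK p 4 * ({A : Set α | A ⊆ M.E ∧ M.eRk A = (p : ℕ∞) ∧ M.eRk (M.E \ A) = (4 : ℕ∞)}.ncard : ℚ) ≤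
      ({A : Set α | A ⊆ M.E ∧ (4 : ℕ∞) < M.eRk A ∧ M.eRk A < (p : ℕ∞)}.ncard : ℚ) :=
  c025_four_twentyseven M p hp

end S1

end PercRepro
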